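import Mathlib.Algebra.Module.ZLattice.Covolume
import Mathlib.Topology.Algebra.InfiniteSum.Real
import HarnessLib

/-!
# Sums over a super-lattice: `Σ_{ξ ∈ L′} w(ξ) ≤ [L′ : L] · sup_a Σ_{x ∈ L} w(a + x)`

Topic `MeasureTheory/Group`; namespace `Literature.MeasureTheory.Group`. KERNEL mathematics only (theorems;
no definition, no named fact, no `axiom`, no `sorry`; Mathlib-only imports). Sequel of
`LatticeSumDilationBound.lean`, whose bound `Σ_{x ∈ L} ∏ gᵢ((a + x)ᵢ/T) ≤ covol(L)⁻¹ ∏ (…)` is UNIFORM IN THE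
TRANSLATE `a`; this file turns such a translation-uniform bound for a lattice `L` into a bound for every
lattice `L′ ⊇ L`, at the cost of the index `[L′ : L] = covol(L) / covol(L′)`.

* §1 (`sum_le_card_quotient_mul`, `summable_and_tsum_le_index_mul`) — additive groups: if `L ≤ L′` are
  subgroups of an additive commutative group `E`, `L` of finite index in `L′`, and `w ≥ 0` on `E` satisfies
  `Σ_{x ∈ L} w(a + x) ≤ M` for every `a ∈ E` (summable), then `Σ_{ξ ∈ L′} w(ξ) ≤ [L′ : L] · M` (summable):
  decompose `L′` into the `[L′ : L]` cosets `a + L`.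
* §2 (`summable_and_tsum_le_covolume_div_mul`) — `ℤ`-lattices in `ℝ^ι`: the same with
  `[L′ : L] = covol(L) / covol(L′)` (Mathlib `ZLattice.covolume_div_covolume_eq_relIndex`).

This is the coset-decomposition step «`𝔡⁻¹ = ⋃ (a + 𝒪)`, `N𝔡` cosets» in the lattice-point estimate of
[Weil1965, Chap. I n° 12, proof of Lemme 5, pp. 21–22] (there: `L ⊂ N⁻¹ Σ ℤ aᵢ`, the sum over the finer lattice
bounding the sum over `L`), used to pass from the ring of integers to the inverses of integral ideals.

## References
* [Weil1965] A. Weil, *Sur la formule de Siegel dans la théorie des groupes classiques*, Acta Math. 113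
  (1965) 1–87: Chap. I n° 12, proof of Lemme 5, pp. 21–22.
-/

set_option autoImplicit false

noncomputable section

open Set Filter Finset MeasureTheory
open scoped BigOperators

namespace Literature.MeasureTheory.Group

/-! ## §1 Additive groups: decomposition into cosets -/

section AddGroup

variable {E : Type*} [AddCommGroup E]

/-- fibrewise bound: for a finite set `S ⊆ L′` and a coset `q` of `L` in `L′`, the part of `Σ_{S} w` lying in `q`
is at most the full translated sum `Σ_{x ∈ L} w(q.out + x) ≤ M`. [folklore] -/
private theorem sum_filter_coset_le {L L' : AddSubgroup E} {w : E → ℝ} (hw0 : ∀ x, 0 ≤ w x)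
    {M : ℝ} (hM : ∀ a : E, Summable (fun x : L => w (a + x)) ∧ ∑' x : L, w (a + x) ≤ M)
    [DecidableEq (L' ⧸ L.addSubgroupOf L')] (S : Finset L') (q : L' ⧸ L.addSubgroupOf L') :
    ∑ ξ ∈ S with (QuotientAddGroup.mk ξ : L' ⧸ L.addSubgroupOf L') = q, w (ξ : E) ≤ M := by
  classical
  -- representative `r` of the coset; every `ξ` in the coset is `r + x`, `x ∈ L`
  set r : L' := q.out with hr
  have hmem : ∀ ξ : L', (QuotientAddGroup.mk ξ : L' ⧸ L.addSubgroupOf L') = q → ((ξ : E) - (r : E)) ∈ L := by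
    intro ξ hξ
    have h1 : (QuotientAddGroup.mk ξ : L' ⧸ L.addSubgroupOf L') = QuotientAddGroup.mk r := by
      rw [hξ, hr, QuotientAddGroup.out_eq']
    rw [QuotientAddGroup.eq] at h1
    rw [AddSubgroup.mem_addSubgroupOf] at h1
    have : ((-ξ + r : L') : E) = -((ξ : E) - (r : E)) := by push_cast; abel
    rw [this] at h1
    exact (neg_mem_iff).1 h1
  -- the injection `ξ ↦ ξ - r` into `L`
  set φ : {ξ // ξ ∈ S.filter fun ξ => (QuotientAddGroup.mk ξ : L' ⧸ L.addSubgroupOf L') = q} → L :=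
    fun ξ => ⟨(ξ.1 : E) - (r : E), hmem ξ.1 (Finset.mem_filter.1 ξ.2).2⟩ with hφ
  have hφinj : Function.Injective φ := by
    intro ξ₁ ξ₂ h
    have h' : ((ξ₁.1 : E) - (r : E)) = (ξ₂.1 : E) - (r : E) := congrArg (fun x : L => (x : E)) h
    have : (ξ₁.1 : E) = (ξ₂.1 : E) := sub_left_injective h'
    exact Subtype.ext (Subtype.ext this)
  obtain ⟨hSa, hMa⟩ := hM (r : E)
  calc ∑ ξ ∈ S with (QuotientAddGroup.mk ξ : L' ⧸ L.addSubgroupOf L') = q, w (ξ : E)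
      = ∑ ξ : {ξ // ξ ∈ S.filter fun ξ => (QuotientAddGroup.mk ξ : L' ⧸ L.addSubgroupOf L') = q},
          w ((r : E) + (φ ξ : E)) := by
        rw [← Finset.sum_coe_sort]
        refine Finset.sum_congr rfl fun ξ _ => ?_
        simp only [hφ, AddSubgroup.coe_mk, add_sub_cancel]
    _ = ∑ x ∈ Finset.univ.image φ, w ((r : E) + (x : E)) := by
        rw [Finset.sum_image fun a _ b _ h => hφinj h]
    _ ≤ ∑' x : L, w ((r : E) + (x : E)) :=
        hSa.sum_le_tsum _ fun x _ => hw0 _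
    _ ≤ M := hMa

/-- **Sum over a super-group of finite index**: if `[L′ : L ∩ L′] < ∞`, `w ≥ 0` and the translated sums over
`L` are uniformly bounded, `Σ_{x ∈ L} w(a + x) ≤ M` for all `a`, then every finite partial sum of `w` over `L′` is
`≤ [L′ : L ∩ L′] · M` (for `L ≤ L′` this is the index `[L′ : L]`). [cite: Weil1965, Chap. I n° 12, proof of Lemme 5, pp. 21–22] -/
theorem sum_le_relIndex_mul {L L' : AddSubgroup E} (hind : L.relIndex L' ≠ 0)
    {w : E → ℝ} (hw0 : ∀ x, 0 ≤ w x) {M : ℝ}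
    (hM : ∀ a : E, Summable (fun x : L => w (a + x)) ∧ ∑' x : L, w (a + x) ≤ M) (S : Finset L') :
    ∑ ξ ∈ S, w (ξ : E) ≤ (L.relIndex L' : ℝ) * M := by
  classical
  haveI : Fintype (L' ⧸ L.addSubgroupOf L') := AddSubgroup.fintypeOfIndexNeZero hind
  have hcard : Fintype.card (L' ⧸ L.addSubgroupOf L') = L.relIndex L' := by
    rw [AddSubgroup.relIndex, AddSubgroup.index_eq_card, Nat.card_eq_fintype_card]
  calc ∑ ξ ∈ S, w (ξ : E)
      = ∑ q : L' ⧸ L.addSubgroupOf L', ∑ ξ ∈ S with (QuotientAddGroup.mk ξ : L' ⧸ L.addSubgroupOf L') = q,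
          w (ξ : E) := (Finset.sum_fiberwise S _ _).symm
    _ ≤ ∑ _q : L' ⧸ L.addSubgroupOf L', M := Finset.sum_le_sum fun q _ => sum_filter_coset_le hw0 hM S q
    _ = (L.relIndex L' : ℝ) * M := by rw [Finset.sum_const, Finset.card_univ, hcard, nsmul_eq_mul]

/-- **Sum over a super-group of finite index** (summable form): under the hypotheses of
`sum_le_relIndex_mul`, `ξ ↦ w(ξ)` is summable over `L′` and `Σ_{ξ ∈ L′} w(ξ) ≤ [L′ : L] · M`.
[cite: Weil1965, Chap. I n° 12, proof of Lemme 5, pp. 21–22] -/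
theorem summable_and_tsum_le_relIndex_mul {L L' : AddSubgroup E} (hind : L.relIndex L' ≠ 0)
    {w : E → ℝ} (hw0 : ∀ x, 0 ≤ w x) {M : ℝ}
    (hM : ∀ a : E, Summable (fun x : L => w (a + x)) ∧ ∑' x : L, w (a + x) ≤ M) :
    Summable (fun ξ : L' => w (ξ : E)) ∧ ∑' ξ : L', w (ξ : E) ≤ (L.relIndex L' : ℝ) * M := by
  have hb := sum_le_relIndex_mul hind hw0 hM
  have hS : Summable (fun ξ : L' => w (ξ : E)) := summable_of_sum_le (fun ξ => hw0 _) hb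
  exact ⟨hS, hS.tsum_le_of_sum_le hb⟩

end AddGroup

/-! ## §2 `ℤ`-lattices in `ℝ^ι`: the index is the ratio of covolumes -/

/-- **Sum over a super-lattice**: for full `ℤ`-lattices `L ≤ L′` in `ℝ^ι` and `w ≥ 0` with translation-uniform
bound `Σ_{x ∈ L} w(a + x) ≤ M` (all `a`), the sum over `L′` is summable and
`Σ_{ξ ∈ L′} w(ξ) ≤ (covol L / covol L′) · M`. [cite: Weil1965, Chap. I n° 12, proof of Lemme 5, pp. 21–22] -/
theorem summable_and_tsum_le_covolume_div_mul {ι : Type*} [Fintype ι] (L L' : Submodule ℤ (ι → ℝ))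
    [DiscreteTopology L] [IsZLattice ℝ L] [DiscreteTopology L'] [IsZLattice ℝ L'] (hLL' : L ≤ L')
    {w : (ι → ℝ) → ℝ} (hw0 : ∀ x, 0 ≤ w x) {M : ℝ}
    (hM : ∀ a : ι → ℝ, Summable (fun x : L => w (a + x)) ∧ ∑' x : L, w (a + x) ≤ M) :
    Summable (fun ξ : L' => w (ξ : ι → ℝ)) ∧
      ∑' ξ : L', w (ξ : ι → ℝ) ≤ ZLattice.covolume L / ZLattice.covolume L' * M := by
  have hrel : (ZLattice.covolume L / ZLattice.covolume L' : ℝ) =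
      (L.toAddSubgroup.relIndex L'.toAddSubgroup : ℝ) := ZLattice.covolume_div_covolume_eq_relIndex L L' hLL'
  have hind : L.toAddSubgroup.relIndex L'.toAddSubgroup ≠ 0 := by
    intro h
    have h0 : (ZLattice.covolume L / ZLattice.covolume L' : ℝ) = 0 := by rw [hrel, h, Nat.cast_zero]
    exact (div_ne_zero (ZLattice.covolume_ne_zero L volume) (ZLattice.covolume_ne_zero L' volume)) h0
  have h := summable_and_tsum_le_relIndex_mul (L := L.toAddSubgroup) (L' := L'.toAddSubgroup) hind hw0
    (M := M) (fun a => hM a)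
  rw [hrel]
  exact h

end Literature.MeasureTheory.Group
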